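import Summits.CriticalPhenomena.PercolationContinuityZ3.Theorems.PercNearOneGluingNearOneGluingQ7ThreeCutAux

/-!
# Crux `PercNearOneGluing.NearOneGluing` (stmt-CriticalPhenomena-4574), line `SketchR2I5` —
# Kozma–Nitzan Question 7 for THREE relays, part II: from `(R3)`, the cut case, the source-reliable case

Lead prover-line-stmt-CriticalPhenomena-4574-c6 (cycle 6).  Lands `--supports stmt-CriticalPhenomena-4574`;
no definitions, no named facts.  Part I (`…Q7ThreeCutAux`) proves the exact decomposition `q7Three_decomp` of the
Question-7 slack `μ(o↔b, o↔A) − μ(z↔b, o↔A)` (`A = {x,y,z}`, `z` least reliable) into the Lemma-3 bracket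
(`q7Three_lemma3 ≥ 0`) and the `x`-bracket, and the BHK inequalities `q7Three_bhk` for the source `x` and the set
`{y, z}`.  Here:

* `q7Three_of_R3`: Kozma–Nitzan's Question 7 for three relays follows from
  `(R3)  0 ≤ μ(D)·[μ({o↔y}∩({y↔b}∖{z↔b})) − μ({o↔y}∩({z↔b}∖{y↔b}))] + μ(D∩{o↔x})·[μ(D∩{x↔b}) − μ(D∩{z↔b})]`,
  `D = {x ↮ y} ∩ {x ↮ z}` (lead c6: 0 violations in ≈ 4 000 exact instances incl. adversarial search; OPEN);
* `q7Three_of_cut`: unconditionally in the CUT CASE `μ(D ∩ {z↔b}) ≤ μ(D ∩ {x↔b})` ("cut off from `y` and `z`,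
  the relay `x` is still at least as reliable as `z`");
* `q7Three_of_source`: unconditionally when the source is at least as reliable as `z` (Lemma 3(i) with `a₂ = o`);
* `conjOneThree_of_cut`: the Conjecture-1 corollary `μ(o↔A)·μ(z↔b) ≤ μ(o↔b)` in the cut case (Harris);
* the registered stub forms `stub_q7ThreeOfR3`, `stub_q7ThreeOfCut`, `stub_conjOneThreeOfCut`.
[cite: KozmaNitzan2024, Question 7 (p. 36), Lemma 3(i) (pp. 6–7), Conjecture 1 (p. 3)]
[cite: VandenbergHaggstromKahn2005, Thms 1.3–1.4]
-/

namespace Summit.CriticalPhenomena.PercolationContinuityZ3.Theorems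

open MeasureTheory Set Literature.Probability.LatticeModels Literature.Probability.Percolation
open scoped Classical BigOperators
open Q7ThreeCut

noncomputable section

variable {n : ℕ}

/-! ### Question 7 for three relays from `(R3)`, and the proved cases -/

/-- **Kozma–Nitzan's Question 7 for three relays, from the inequality `(R3)`.**  With `D = {x ↮ y} ∩ {x ↮ z}`,
if `μ(z↔b) ≤ μ(y↔b)` and
`(R3)  0 ≤ μ(D)·[μ({o↔y}∩({y↔b}∖{z↔b})) − μ({o↔y}∩({z↔b}∖{y↔b}))] + μ(D∩{o↔x})·[μ(D∩{x↔b}) − μ(D∩{z↔b})]`,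
then `μ({z↔b} ∩ oA) ≤ μ({o↔b} ∩ oA)` for `oA = {o↔x} ∪ {o↔y} ∪ {o↔z}`.
Proof: `q7Three_decomp`, `q7Three_lemma3`, and `q7Three_bhk` (which turns `μ(D)·(x`-bracket`)` into
`≥ μ(D∩{o↔x})·[μ(D∩{x↔b}) − μ(D∩{z↔b})]`); if `μ(D) = 0` the `x`-bracket vanishes.
[cite: KozmaNitzan2024, Question 7 (p. 36)] -/
theorem q7Three_of_R3 (w : Sym2 (Fin n) → unitInterval) (o b x y z : Fin n) (hxy : x ≠ y) (hxz : x ≠ z)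
    (hyz : (prodBernoulli w).real (openConn z b) ≤ (prodBernoulli w).real (openConn y b))
    (hR3 : 0 ≤ (prodBernoulli w).real ((openConn x y)ᶜ ∩ (openConn x z)ᶜ) *
        ((prodBernoulli w).real (openConn o y ∩ (openConn y b \ openConn z b)) -
          (prodBernoulli w).real (openConn o y ∩ (openConn z b \ openConn y b))) +
      (prodBernoulli w).real (((openConn x y)ᶜ ∩ (openConn x z)ᶜ) ∩ openConn o x) *
        ((prodBernoulli w).real (((openConn x y)ᶜ ∩ (openConn x z)ᶜ) ∩ openConn x b) -
          (prodBernoulli w).real (((openConn x y)ᶜ ∩ (openConn x z)ᶜ) ∩ openConn z b))) :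
    (prodBernoulli w).real (openConn z b ∩ (openConn o x ∪ openConn o y ∪ openConn o z)) ≤
      (prodBernoulli w).real (openConn o b ∩ (openConn o x ∪ openConn o y ∪ openConn o z)) := by
  set μ := prodBernoulli w with hμ
  set D : Set (BondConfig (Fin n)) := (openConn x y)ᶜ ∩ (openConn x z)ᶜ with hD
  have hdec := q7Three_decomp w o b x y z
  have hl3 := q7Three_lemma3 w o b y z hyz
  obtain ⟨h13, h14⟩ := q7Three_bhk w o b x y z hxy hxz
  simp only [← hD] at hdec h13 h14 hR3 ⊢
  set lam := μ.real (openConn o y ∩ (openConn y b \ openConn z b)) -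
    μ.real (openConn o y ∩ (openConn z b \ openConn y b)) with hlam
  set U₁ := μ.real (D ∩ openConn o x ∩ openConn x b) with hU₁
  set U₂ := μ.real (D ∩ openConn o x ∩ openConn z b) with hU₂
  have hlam0 : 0 ≤ lam := by rw [hlam]; linarith
  by_cases hD0 : μ.real D = 0
  · -- the `x`-bracket vanishes
    have hU₁0 : U₁ = 0 := le_antisymm
      ((measureReal_mono (show D ∩ openConn o x ∩ openConn x b ⊆ D from
        fun ω h => h.1.1)).trans hD0.le) measureReal_nonneg
    have hU₂0 : U₂ = 0 := le_antisymm
      ((measureReal_mono (show D ∩ openConn o x ∩ openConn z b ⊆ D from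
        fun ω h => h.1.1)).trans hD0.le) measureReal_nonneg
    rw [hU₁0, hU₂0] at hdec
    linarith
  · have hDpos : 0 < μ.real D := lt_of_le_of_ne measureReal_nonneg (Ne.symm hD0)
    -- `μ(D)·(U₁ − U₂) ≥ μ(D∩{o↔x})·(μ(D∩{x↔b}) − μ(D∩{z↔b}))`
    have hx : μ.real (D ∩ openConn o x) * (μ.real (D ∩ openConn x b) - μ.real (D ∩ openConn z b)) ≤
        μ.real D * (U₁ - U₂) := by
      rw [mul_sub, mul_sub]
      linarith
    -- so `μ(D)·(lam + (U₁ − U₂)) ≥ R3 ≥ 0`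
    have hprod : 0 ≤ μ.real D * (lam + (U₁ - U₂)) := by nlinarith
    have hsum : 0 ≤ lam + (U₁ - U₂) := by
      by_contra hneg
      have : μ.real D * (lam + (U₁ - U₂)) < 0 := mul_neg_of_pos_of_neg hDpos (lt_of_not_ge hneg)
      linarith
    linarith

/-- **Question 7 for three relays in the CUT case.**  If `μ(z↔b) ≤ μ(y↔b)` and, with `D = {x ↮ y} ∩ {x ↮ z}`,
`μ(D ∩ {z↔b}) ≤ μ(D ∩ {x↔b})` ("cut off from `y` and `z`, the relay `x` is still at least as reliable as `z`"),
then `μ({z↔b} ∩ oA) ≤ μ({o↔b} ∩ oA)`, `oA = {o↔x} ∪ {o↔y} ∪ {o↔z}` — Kozma–Nitzan's inequality (41) with the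
least reliable relay `z`.  (`(R3)` holds trivially: both of its terms are nonnegative.)
[cite: KozmaNitzan2024, Question 7 (p. 36)] -/
theorem q7Three_of_cut (w : Sym2 (Fin n) → unitInterval) (o b x y z : Fin n) (hxy : x ≠ y) (hxz : x ≠ z)
    (hyz : (prodBernoulli w).real (openConn z b) ≤ (prodBernoulli w).real (openConn y b))
    (hcut : (prodBernoulli w).real (((openConn x y)ᶜ ∩ (openConn x z)ᶜ) ∩ openConn z b) ≤
      (prodBernoulli w).real (((openConn x y)ᶜ ∩ (openConn x z)ᶜ) ∩ openConn x b)) :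
    (prodBernoulli w).real (openConn z b ∩ (openConn o x ∪ openConn o y ∪ openConn o z)) ≤
      (prodBernoulli w).real (openConn o b ∩ (openConn o x ∪ openConn o y ∪ openConn o z)) := by
  refine q7Three_of_R3 w o b x y z hxy hxz hyz ?_
  have hl3 := q7Three_lemma3 w o b y z hyz
  exact add_nonneg (mul_nonneg measureReal_nonneg (by linarith)) (mul_nonneg measureReal_nonneg (by linarith))

/-- **Question 7 for three relays with a RELIABLE SOURCE.**  If `μ(z↔b) ≤ μ(o↔b)` then
`μ({z↔b} ∩ oA) ≤ μ({o↔b} ∩ oA)`, `oA = {o↔x} ∪ {o↔y} ∪ {o↔z}`: Kozma–Nitzan's Lemma 3(i) with `a₁ = z`,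
`a₂ = o` and the event `Q = oA`, increasing in the open edge cluster of `o`.
[cite: KozmaNitzan2024, Lemma 3(i) (pp. 6–7), Question 7 (p. 36)] -/
theorem q7Three_of_source (w : Sym2 (Fin n) → unitInterval) (o b x y z : Fin n)
    (hoz : (prodBernoulli w).real (openConn z b) ≤ (prodBernoulli w).real (openConn o b)) :
    (prodBernoulli w).real (openConn z b ∩ (openConn o x ∪ openConn o y ∪ openConn o z)) ≤
      (prodBernoulli w).real (openConn o b ∩ (openConn o x ∪ openConn o y ∪ openConn o z)) := by
  have hQ : ∀ ω ω', ω ∈ (openConn o x ∪ openConn o y ∪ openConn o z : Set (BondConfig (Fin n))) →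
      openEdgeCluster ω o ⊆ openEdgeCluster ω' o →
      ω' ∈ (openConn o x ∪ openConn o y ∪ openConn o z : Set (BondConfig (Fin n))) := by
    intro ω ω' hω hsub
    rcases hω with (h | h) | h
    · exact Or.inl (Or.inl (pivDom_openConn_mono_openEdgeCluster o x ω ω' h hsub))
    · exact Or.inl (Or.inr (pivDom_openConn_mono_openEdgeCluster o y ω ω' h hsub))
    · exact Or.inr (pivDom_openConn_mono_openEdgeCluster o z ω ω' h hsub)
  have key := knLemma3i n w z o b _ 0 hQ le_rfl (by linarith)
  linarith

/-- **Conjecture 1 for three relays in the cut case** (corollary): under the hypotheses of `q7Three_of_cut`,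
`μ(o ↔ A) · μ(z ↔ b) ≤ μ(o ↔ b)` with `{o ↔ A} = {o↔x} ∪ {o↔y} ∪ {o↔z}`; since `z` is the least reliable
relay this is `μ(o↔b) ≥ μ(o↔A) · min_a μ(a↔b)` (Kozma–Nitzan Conjecture 1 for `A = {x, y, z}`).  From
`q7Three_of_cut`, Harris' inequality for the increasing events `{z↔b}`, `{o↔A}`, and monotonicity.
[cite: KozmaNitzan2024, Conjecture 1 (p. 3)] -/
theorem conjOneThree_of_cut (w : Sym2 (Fin n) → unitInterval) (o b x y z : Fin n) (hxy : x ≠ y) (hxz : x ≠ z)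
    (hyz : (prodBernoulli w).real (openConn z b) ≤ (prodBernoulli w).real (openConn y b))
    (hcut : (prodBernoulli w).real (((openConn x y)ᶜ ∩ (openConn x z)ᶜ) ∩ openConn z b) ≤
      (prodBernoulli w).real (((openConn x y)ᶜ ∩ (openConn x z)ᶜ) ∩ openConn x b)) :
    (prodBernoulli w).real (openConn o x ∪ openConn o y ∪ openConn o z) *
        (prodBernoulli w).real (openConn z b) ≤
      (prodBernoulli w).real (openConn o b) := by
  have hq7 := q7Three_of_cut w o b x y z hxy hxz hyz hcut
  have hup : IsUpperSet (openConn o x ∪ openConn o y ∪ openConn o z : Set (BondConfig (Fin n))) :=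
    ((isUpperSet_openConn o x).union (isUpperSet_openConn o y)).union (isUpperSet_openConn o z)
  have hhar := prodBernoulli_harris w (isUpperSet_openConn z b) hup MeasurableSet.of_discrete
    MeasurableSet.of_discrete
  have hmono : (prodBernoulli w).real (openConn o b ∩ (openConn o x ∪ openConn o y ∪ openConn o z)) ≤
      (prodBernoulli w).real (openConn o b) := measureReal_mono inter_subset_left
  nlinarith [hhar, hq7, hmono, mul_comm ((prodBernoulli w).real (openConn o x ∪ openConn o y ∪ openConn o z))
    ((prodBernoulli w).real (openConn z b))]

/-! ### Registered stub forms (explicit `∀ n`, fully qualified) -/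

/-- Registered stub form of `q7Three_of_R3` (Question 7 for three relays from `(R3)`).
[cite: KozmaNitzan2024, Question 7 (p. 36)] -/
theorem stub_q7ThreeOfR3 : ∀ (n : ℕ) (w : Sym2 (Fin n) → unitInterval) (o b x y z : Fin n), x ≠ y → x ≠ z → (Literature.Probability.LatticeModels.prodBernoulli w).real (Literature.Probability.Percolation.openConn z b) ≤ (Literature.Probability.LatticeModels.prodBernoulli w).real (Literature.Probability.Percolation.openConn y b) → 0 ≤ (Literature.Probability.LatticeModels.prodBernoulli w).real ((Literature.Probability.Percolation.openConn x y)ᶜ ∩ (Literature.Probability.Percolation.openConn x z)ᶜ) * ((Literature.Probability.LatticeModels.prodBernoulli w).real (Literature.Probability.Percolation.openConn o y ∩ (Literature.Probability.Percolation.openConn y b \ Literature.Probability.Percolation.openConn z b)) - (Literature.Probability.LatticeModels.prodBernoulli w).real (Literature.Probability.Percolation.openConn o y ∩ (Literature.Probability.Percolation.openConn z b \ Literature.Probability.Percolation.openConn y b))) + (Literature.Probability.LatticeModels.prodBernoulli w).real (((Literature.Probability.Percolation.openConn x y)ᶜ ∩ (Literature.Probability.Percolation.openConn x z)ᶜ)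 ∩ Literature.Probability.Percolation.openConn o x) * ((Literature.Probability.LatticeModels.prodBernoulli w).real (((Literature.Probability.Percolation.openConn x y)ᶜ ∩ (Literature.Probability.Percolation.openConn x z)ᶜ) ∩ Literature.Probability.Percolation.openConn x b) - (Literature.Probability.LatticeModels.prodBernoulli w).real (((Literature.Probability.Percolation.openConn x y)ᶜ ∩ (Literature.Probability.Percolation.openConn x z)ᶜ) ∩ Literature.Probability.Percolation.openConn z b)) → (Literature.Probability.LatticeModels.prodBernoulli w).real (Literature.Probability.Percolation.openConn z b ∩ (Literature.Probability.Percolation.openConn o x ∪ Literature.Probability.Percolation.openConn o y ∪ Literature.Probability.Percolation.openConn o z)) ≤ (Literature.Probability.LatticeModels.prodBernoulli w).real (Literature.Probability.Percolation.openConn o b ∩ (Literature.Probability.Percolation.openConn o x ∪ Literature.Probability.Percolation.openConn o y ∪ Literature.Probability.Percolation.openConn o z)) :=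
  fun _ w o b x y z hxy hxz hyz hR3 => q7Three_of_R3 w o b x y z hxy hxz hyz hR3

/-- Registered stub form of `q7Three_of_cut` (Question 7 for three relays, cut case).
[cite: KozmaNitzan2024, Question 7 (p. 36)] -/
theorem stub_q7ThreeOfCut : ∀ (n : ℕ) (w : Sym2 (Fin n) → unitInterval) (o b x y z : Fin n), x ≠ y → x ≠ z → (Literature.Probability.LatticeModels.prodBernoulli w).real (Literature.Probability.Percolation.openConn z b) ≤ (Literature.Probability.LatticeModels.prodBernoulli w).real (Literature.Probability.Percolation.openConn y b) → (Literature.Probability.LatticeModels.prodBernoulli w).real (((Literature.Probability.Percolation.openConn x y)ᶜ ∩ (Literature.Probability.Percolation.openConn x z)ᶜ) ∩ Literature.Probability.Percolation.openConn z b) ≤ (Literature.Probability.LatticeModels.prodBernoulli w).real (((Literature.Probability.Percolation.openConn x y)ᶜ ∩ (Literature.Probability.Percolation.openConn x z)ᶜ) ∩ Literature.Probability.Percolation.openConn x b) → (Literature.Probability.LatticeModels.prodBernoulli w).real (Literature.Probability.Percolation.openConn z b ∩ (Literature.Probability.Percolation.openConn o x ∪ Literature.Probability.Percolation.openConn o y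 ∪ Literature.Probability.Percolation.openConn o z)) ≤ (Literature.Probability.LatticeModels.prodBernoulli w).real (Literature.Probability.Percolation.openConn o b ∩ (Literature.Probability.Percolation.openConn o x ∪ Literature.Probability.Percolation.openConn o y ∪ Literature.Probability.Percolation.openConn o z)) :=
  fun _ w o b x y z hxy hxz hyz hcut => q7Three_of_cut w o b x y z hxy hxz hyz hcut

/-- Registered stub form of `conjOneThree_of_cut` (Conjecture 1 for three relays, cut case).
[cite: KozmaNitzan2024, Conjecture 1 (p. 3)] -/
theorem stub_conjOneThreeOfCut : ∀ (n : ℕ) (w : Sym2 (Fin n) → unitInterval) (o b x y z : Fin n), x ≠ y → x ≠ z → (Literature.Probability.LatticeModels.prodBernoulli w).real (Literature.Probability.Percolation.openConn z b) ≤ (Literature.Probability.LatticeModels.prodBernoulli w).real (Literature.Probability.Percolation.openConn y b) → (Literature.Probability.LatticeModels.prodBernoulli w).real (((Literature.Probability.Percolation.openConn x y)ᶜ ∩ (Literature.Probability.Percolation.openConn x z)ᶜ) ∩ Literature.Probability.Percolation.openConn z b) ≤ (Literature.Probability.LatticeModels.prodBernoulli w).real (((Literature.Probability.Percolation.openConn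 x y)ᶜ ∩ (Literature.Probability.Percolation.openConn x z)ᶜ) ∩ Literature.Probability.Percolation.openConn x b) → (Literature.Probability.LatticeModels.prodBernoulli w).real (Literature.Probability.Percolation.openConn o x ∪ Literature.Probability.Percolation.openConn o y ∪ Literature.Probability.Percolation.openConn o z) * (Literature.Probability.LatticeModels.prodBernoulli w).real (Literature.Probability.Percolation.openConn z b) ≤ (Literature.Probability.LatticeModels.prodBernoulli w).real (Literature.Probability.Percolation.openConn o b) :=
  fun _ w o b x y z hxy hxz hyz hcut => conjOneThree_of_cut w o b x y z hxy hxz hyz hcut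

end

end Summit.CriticalPhenomena.PercolationContinuityZ3.Theorems
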